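import Summits.Ventures.CertifiedManyBodySolver.Downfold.EmeryBandEigenvalues
import Summits.Ventures.CertifiedManyBodySolver.Downfold.EmeryHybridisationSubquadratic
import HarnessLib

/-!
# THE OXYGEN-HOPPING LIPSCHITZ BOUNDS: the antibonding band and the Fermi energy move by at most `4·|δt_pp′|` and `4·|δt_pp|` — the two O–O
# directions of the σ row are 4-LIPSCHITZ (Rayleigh quotient at the top eigenvector); with §B.83 (f), (h) and §B.85 (d) all four one-body
# directions of `ε_F` now carry an explicit two-sided modulus

Venture CertifiedManyBodySolver, cell `pub/hubbard-downfold` (stage S1; INFLATION-RULES-3to1-B §B.85 (q)–(t)), seat hubbard-downfold-mod-4 (technique B = band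
level, g35); namespace `Summit.Ventures.CertifiedManyBodySolver.Downfold.Emery`. Everything PROVED (0 sorry, no definition). WHAT THIS IS NOT: a statement
about any material; `U = 0` one-body kinematics of the σ (d–p_x–p_y + t_pp, t_pp′) model; no number lives here.

`EmeryHoppingLevers` (§B.83 (h)) signed the oxygen directions (`t_pp ↑` raises, `t_pp′ ↑` lowers the band and the Fermi energy) with no modulus;
`EmeryChargeTransferLipschitz` gave the Δ direction its modulus 1 by a determinant identity. For `t_pp`, `t_pp′` the perturbation is not a multiple of the
identity, so this file uses the eigenvalue language of `EmeryBandEigenvalues` (the antibonding band IS the top eigenvalue of `bloch4`; Rayleigh bounds):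

* §1 QUADRATIC-FORM SHIFTS (`rayleigh_bloch4_tppP_shift`, `rayleigh_bloch4_tpp_shift`): `q·H(c + γ)q = q·H(c)q − 4γ(sx²q₁² + sy²q₂²)` and
  `q·H(b + β)q = q·H(b)q − 8β·sx·sy·q₁q₂` (`bloch4` is affine in `t_pp′` on the p-diagonal and in `t_pp` on the p–p off-diagonal).
* §2 A TOP EIGENVECTOR EXISTS (`exists_eigenvector_abBand`): `∃ v ≠ 0, H v = ε_AB·v` (Mathlib's orthonormal eigenvector basis + `abBand_eq_band3_zero`).
* §3 **THE BAND BOUNDS**: for `γ, β ≥ 0` and `sx², sy² ≤ 1`: **`ε_AB(c) − 4γ ≤ ε_AB(c + γ) ≤ ε_AB(c)`** (`abBand_sub_le_abBand_tppP_shift`; finer: `− 4γ·m` for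
  `sx², sy² ≤ m`) and **`ε_AB(b) ≤ ε_AB(b + β) ≤ ε_AB(b) + 4β`** (`abBand_tpp_shift_le`; finer: `+ 4β·m` for `|sx·sy| ≤ m`). Proof: the Rayleigh quotient
  of the shifted matrix at the top eigenvector of the unshifted one (resp. vice versa) and `le_eigenvalues₀_zero_of_rayleigh`. `(x, y)` forms via `√`.
* §4 **THE FERMI-ENERGY BOUNDS** (`fermiEnergyOf_sub_le_tppP_shift`, `fermiEnergyOf_tpp_shift_le`, certificate-free `…'`; brackets `…_mem_Icc`):
  **`ε_F(c) − 4γ ≤ ε_F(c + γ) ≤ ε_F(c)`** and **`ε_F(b) ≤ ε_F(b + β) ≤ ε_F(b) + 4β`** at every filling `0 < ν < 1` (occupied-set inclusion with an energy shift,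
  as in §B.83 (f)). SUMMARY OF THE MODULI OF `ε_F` (one-body row of a typed box): `|∂_Δ| ≤ 1` (§B.83 (f)), `ε_F(a) ≤ ε_F(a′) ≤ (a′/a)²ε_F(a)` (§B.85 (d)),
  `|∂_{t_pp}| ≤ 4`, `|∂_{t_pp′}| ≤ 4` (here) — an EXPLICIT joint Lipschitz modulus on every typed box (the continuity of §B.83 (a)–(e) made quantitative),
  usable to price a box's Fermi-energy width without any certificate: `w(ε_F) ≤ w(Δ) + (a₂²/a₁² − 1)·ε_F(low corner… ) + 4w(t_pp) + 4w(t_pp′)`.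

Sources: three-band model [HybertsenSchluterChristensen1989, Eq. (1)]; Rayleigh–Ritz [HornJohnson2013, Thm 4.2.6] via `EmeryBandEigenvalues`; [folklore].
-/

noncomputable section

namespace Summit.Ventures.CertifiedManyBodySolver.Downfold.Emery

open Real Matrix WithLp MeasureTheory Set

/-! ## §1 Quadratic-form shifts -/

/-- `q·H(c + γ)q = q·H(c)q − 4γ(sx²q₁² + sy²q₂²)`. [folklore] -/
theorem rayleigh_bloch4_tppP_shift (Δ tpd tpp c γ sx sy : ℝ) (q : Fin 3 → ℝ) :
    q ⬝ᵥ (bloch4 Δ tpd tpp (c + γ) sx sy *ᵥ q) =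
      q ⬝ᵥ (bloch4 Δ tpd tpp c sx sy *ᵥ q) - 4 * γ * (sx ^ 2 * q 1 ^ 2 + sy ^ 2 * q 2 ^ 2) := by
  simp [bloch4, Matrix.mulVec, dotProduct, Fin.sum_univ_three]
  ring

/-- `q·H(b + β)q = q·H(b)q − 8β·sx·sy·q₁q₂`. [folklore] -/
theorem rayleigh_bloch4_tpp_shift (Δ tpd tpp β c sx sy : ℝ) (q : Fin 3 → ℝ) :
    q ⬝ᵥ (bloch4 Δ tpd (tpp + β) c sx sy *ᵥ q) =
      q ⬝ᵥ (bloch4 Δ tpd tpp c sx sy *ᵥ q) - 8 * β * sx * sy * (q 1 * q 2) := by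
  simp [bloch4, Matrix.mulVec, dotProduct, Fin.sum_univ_three]
  ring

/-! ## §2 A top eigenvector -/

/-- **There is a non-zero vector `v` with `H v = ε_AB·v`** (`H = bloch4` at `(sx, sy)`, `ε_AB = abBand(sx², sy²)`). [cite: HornJohnson2013, Thm 4.2.6] -/
theorem exists_eigenvector_abBand (Δ tpd tpp c sx sy : ℝ) :
    ∃ v : Fin 3 → ℝ, v ≠ 0 ∧ bloch4 Δ tpd tpp c sx sy *ᵥ v = abBand Δ tpd tpp c (sx ^ 2) (sy ^ 2) • v := by
  set hH := bloch4_isHermitian Δ tpd tpp c sx sy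
  set i₀ : Fin 3 := Fintype.equivOfCardEq (Fintype.card_fin _) ⟨0, by simp⟩ with hi₀
  refine ⟨⇑(hH.eigenvectorBasis i₀), (ofLp_eq_zero 2).ne.2 (hH.eigenvectorBasis.orthonormal.ne_zero i₀), ?_⟩
  have h := hH.mulVec_eigenvectorBasis i₀
  rw [hi₀, eigenvalues_equiv_apply] at h
  rw [abBand_eq_band3_zero]
  exact h

/-! ## §3 The band bounds -/

section Band

variable {Δ tpd tpp c sx sy : ℝ}

/-- **`ε_AB(c) − 4γ·m ≤ ε_AB(c + γ)`** for `γ ≥ 0`, `0 ≤ m`, `sx² ≤ m`, `sy² ≤ m` (Rayleigh quotient of `H(c + γ)` at the top eigenvector of `H(c)`).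
[cite: HornJohnson2013, Thm 4.2.6] -/
theorem abBand_sub_le_abBand_tppP_shift' {γ m : ℝ} (hγ : 0 ≤ γ) (hm : 0 ≤ m) (hx : sx ^ 2 ≤ m) (hy : sy ^ 2 ≤ m) :
    abBand Δ tpd tpp c (sx ^ 2) (sy ^ 2) - 4 * γ * m ≤ abBand Δ tpd tpp (c + γ) (sx ^ 2) (sy ^ 2) := by
  obtain ⟨v, hv0, hv⟩ := exists_eigenvector_abBand Δ tpd tpp c sx sy
  set E := abBand Δ tpd tpp c (sx ^ 2) (sy ^ 2) with hE
  have hHv : v ⬝ᵥ (bloch4 Δ tpd tpp c sx sy *ᵥ v) = E * (v ⬝ᵥ v) := by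
    rw [hv, dotProduct_smul, smul_eq_mul]
  rw [abBand_eq_band3_zero (c := c + γ)]
  refine le_eigenvalues₀_zero_of_rayleigh (bloch4_isHermitian Δ tpd tpp (c + γ) sx sy) hv0 ?_
  have hvv : v ⬝ᵥ v = v 0 ^ 2 + v 1 ^ 2 + v 2 ^ 2 := by
    simp [dotProduct, Fin.sum_univ_three]; ring
  rw [rayleigh_bloch4_tppP_shift, hHv, hvv]
  have h1 : sx ^ 2 * v 1 ^ 2 + sy ^ 2 * v 2 ^ 2 ≤ m * (v 0 ^ 2 + v 1 ^ 2 + v 2 ^ 2) := by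
    nlinarith [mul_le_mul_of_nonneg_right hx (sq_nonneg (v 1)), mul_le_mul_of_nonneg_right hy (sq_nonneg (v 2)),
      mul_nonneg hm (sq_nonneg (v 0))]
  nlinarith [mul_le_mul_of_nonneg_left h1 (by positivity : 0 ≤ 4 * γ)]

/-- **`ε_AB(b + β) ≤ ε_AB(b) + 4β·m`** for `β ≥ 0`, `|sx·sy| ≤ m` (Rayleigh quotient of `H(b)` at the top eigenvector of `H(b + β)`).
[cite: HornJohnson2013, Thm 4.2.6] -/
theorem abBand_tpp_shift_le' {β m : ℝ} (hβ : 0 ≤ β) (hm : |sx * sy| ≤ m) :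
    abBand Δ tpd (tpp + β) c (sx ^ 2) (sy ^ 2) ≤ abBand Δ tpd tpp c (sx ^ 2) (sy ^ 2) + 4 * β * m := by
  obtain ⟨w, hw0, hw⟩ := exists_eigenvector_abBand Δ tpd (tpp + β) c sx sy
  set E' := abBand Δ tpd (tpp + β) c (sx ^ 2) (sy ^ 2) with hE'
  have hHw : w ⬝ᵥ (bloch4 Δ tpd (tpp + β) c sx sy *ᵥ w) = E' * (w ⬝ᵥ w) := by
    rw [hw, dotProduct_smul, smul_eq_mul]
  have hm0 : 0 ≤ m := (abs_nonneg _).trans hm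
  suffices h : E' - 4 * β * m ≤ abBand Δ tpd tpp c (sx ^ 2) (sy ^ 2) by linarith
  rw [abBand_eq_band3_zero (tpp := tpp)]
  refine le_eigenvalues₀_zero_of_rayleigh (bloch4_isHermitian Δ tpd tpp c sx sy) hw0 ?_
  have hshift := rayleigh_bloch4_tpp_shift Δ tpd tpp β c sx sy w
  -- w·H(b)w = E'|w|² + 8β sx sy w₁w₂ ≥ E'|w|² − 4βm(w₁² + w₂²)
  have hq : w ⬝ᵥ (bloch4 Δ tpd tpp c sx sy *ᵥ w) = E' * (w ⬝ᵥ w) + 8 * β * sx * sy * (w 1 * w 2) := by linarith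
  have hww : w ⬝ᵥ w = w 0 ^ 2 + w 1 ^ 2 + w 2 ^ 2 := by
    simp [dotProduct, Fin.sum_univ_three]; ring
  rw [hq, hww]
  have h1 : |sx * sy * (w 1 * w 2)| ≤ m * ((w 1 ^ 2 + w 2 ^ 2) / 2) := by
    rw [abs_mul]
    refine mul_le_mul hm ?_ (abs_nonneg _) hm0
    rw [abs_le]; constructor <;> nlinarith [sq_nonneg (w 1 + w 2), sq_nonneg (w 1 - w 2)]
  have h2 : -(m * ((w 1 ^ 2 + w 2 ^ 2) / 2)) ≤ sx * sy * (w 1 * w 2) := by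
    have := neg_abs_le (sx * sy * (w 1 * w 2)); linarith
  nlinarith [mul_le_mul_of_nonneg_left h2 (by positivity : 0 ≤ 8 * β), mul_nonneg (mul_nonneg (by positivity : (0:ℝ) ≤ 4 * β) hm0) (sq_nonneg (w 0))]

/-- `(x, y)` form, `0 ≤ x, y ≤ 1`: **`ε_AB(c) − 4γ ≤ ε_AB(c + γ)`** (`γ ≥ 0`). [folklore] -/
theorem abBand_sub_le_abBand_tppP_shift {x y γ : ℝ} (hx : 0 ≤ x) (hx1 : x ≤ 1) (hy : 0 ≤ y) (hy1 : y ≤ 1) (hγ : 0 ≤ γ) :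
    abBand Δ tpd tpp c x y - 4 * γ ≤ abBand Δ tpd tpp (c + γ) x y := by
  have h := abBand_sub_le_abBand_tppP_shift' (Δ := Δ) (tpd := tpd) (tpp := tpp) (c := c) (sx := Real.sqrt x) (sy := Real.sqrt y) (m := 1)
    hγ zero_le_one (by rw [Real.sq_sqrt hx]; exact hx1) (by rw [Real.sq_sqrt hy]; exact hy1)
  rw [Real.sq_sqrt hx, Real.sq_sqrt hy, mul_one] at h
  exact h

/-- `(x, y)` form, `0 ≤ x, y ≤ 1`: **`ε_AB(b + β) ≤ ε_AB(b) + 4β`** (`β ≥ 0`). [folklore] -/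
theorem abBand_tpp_shift_le {x y β : ℝ} (hx : 0 ≤ x) (hx1 : x ≤ 1) (hy : 0 ≤ y) (hy1 : y ≤ 1) (hβ : 0 ≤ β) :
    abBand Δ tpd (tpp + β) c x y ≤ abBand Δ tpd tpp c x y + 4 * β := by
  have hm : |Real.sqrt x * Real.sqrt y| ≤ 1 := by
    rw [abs_le]
    have h1 : Real.sqrt x ≤ 1 := by simpa using Real.sqrt_le_sqrt hx1
    have h2 : Real.sqrt y ≤ 1 := by simpa using Real.sqrt_le_sqrt hy1
    have h3 : 0 ≤ Real.sqrt x := Real.sqrt_nonneg x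
    have h4 : 0 ≤ Real.sqrt y := Real.sqrt_nonneg y
    constructor <;> nlinarith [mul_nonneg h3 h4, mul_le_mul h1 h2 h4 zero_le_one]
  have h := abBand_tpp_shift_le' (Δ := Δ) (tpd := tpd) (tpp := tpp) (c := c) (sx := Real.sqrt x) (sy := Real.sqrt y) (m := 1) hβ hm
  rw [Real.sq_sqrt hx, Real.sq_sqrt hy, mul_one] at h
  exact h

end Band

/-! ## §4 The Fermi-energy bounds -/

section Filling

variable {Δ a b c : ℝ}

/-- `abFilling(c + γ; ε) ≤ abFilling(c; ε + 4γ)` (`γ ≥ 0`): raising `t_pp′` lowers no state by more than `4γ`. [folklore] -/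
theorem abFilling_tppP_shift_le_abFilling_add {γ : ℝ} (hγ : 0 ≤ γ) (ε : ℝ) :
    abFilling Δ a b (c + γ) ε ≤ abFilling Δ a b c (ε + 4 * γ) := by
  unfold abFilling
  refine div_le_div_of_nonneg_right ?_ (by positivity)
  refine ENNReal.toReal_mono (volume_abOccSet_ne_top _ _ _ _ _) (measure_mono ?_)
  intro k hk
  refine ⟨hk.1, ?_⟩
  have h := abBand_sub_le_abBand_tppP_shift (Δ := Δ) (tpd := a) (tpp := b) (c := c) (halfSq_nonneg k.1) (halfSq_le_one k.1)
    (halfSq_nonneg k.2) (halfSq_le_one k.2) hγ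
  have h2 : abBand Δ a b (c + γ) (halfSq k.1) (halfSq k.2) ≤ ε := hk.2
  show abBand Δ a b c (halfSq k.1) (halfSq k.2) ≤ ε + 4 * γ
  linarith

/-- `abFilling(b; ε) ≤ abFilling(b + β; ε + 4β)` (`β ≥ 0`): raising `t_pp` raises no state by more than `4β`. [folklore] -/
theorem abFilling_le_abFilling_tpp_shift_add {β : ℝ} (hβ : 0 ≤ β) (ε : ℝ) :
    abFilling Δ a b c ε ≤ abFilling Δ a (b + β) c (ε + 4 * β) := by
  unfold abFilling
  refine div_le_div_of_nonneg_right ?_ (by positivity)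
  refine ENNReal.toReal_mono (volume_abOccSet_ne_top _ _ _ _ _) (measure_mono ?_)
  intro k hk
  refine ⟨hk.1, ?_⟩
  have h := abBand_tpp_shift_le (Δ := Δ) (tpd := a) (tpp := b) (c := c) (halfSq_nonneg k.1) (halfSq_le_one k.1)
    (halfSq_nonneg k.2) (halfSq_le_one k.2) hβ
  have h2 : abBand Δ a b c (halfSq k.1) (halfSq k.2) ≤ ε := hk.2
  show abBand Δ a (b + β) c (halfSq k.1) (halfSq k.2) ≤ ε + 4 * β
  linarith

end Filling

section Fermi

variable {Δ a b c ν : ℝ}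

/-- **`ε_F(c; ν) − 4γ ≤ ε_F(c + γ; ν)`** (`γ ≥ 0`; `0 < ν < 1` attained at both rows). [folklore] -/
theorem fermiEnergyOf_sub_le_tppP_shift {γ : ℝ} (hΔ : 0 ≤ Δ) (hc : 0 ≤ c) (hb : 0 ≤ b) (hγ : 0 ≤ γ) (hν0 : 0 < ν) (hν1 : ν < 1)
    (hex : ∃ ε : ℝ, abFilling Δ a b c ε = ν) (hex' : ∃ ε : ℝ, abFilling Δ a b (c + γ) ε = ν) :
    fermiEnergyOf Δ a b c ν - 4 * γ ≤ fermiEnergyOf Δ a b (c + γ) ν := by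
  have hc' : 0 ≤ c + γ := by linarith
  have h : abFilling Δ a b c (fermiEnergyOf Δ a b c ν) = ν := abFilling_fermiEnergyOf hΔ hc hb hν0 hν1 hex
  have h' : abFilling Δ a b (c + γ) (fermiEnergyOf Δ a b (c + γ) ν) = ν := abFilling_fermiEnergyOf hΔ hc' hb hν0 hν1 hex'
  by_contra hlt
  push Not at hlt
  have hlt' : fermiEnergyOf Δ a b (c + γ) ν + 4 * γ < fermiEnergyOf Δ a b c ν := by linarith
  obtain ⟨k, hk, hkE⟩ := exists_gt_of_abFilling_lt_one (Δ := Δ) (a := a) (b := b) (c := c)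
    (ε := fermiEnergyOf Δ a b c ν) (by rw [h]; exact hν1)
  have h0 : 0 ≤ fermiEnergyOf Δ a b (c + γ) ν + 4 * γ := by
    have := fermiEnergyOf_nonneg hΔ hc' hb hν0 hν1 hex'; linarith
  have hstrict := abFilling_lt_abFilling (a := a) hΔ hc hb h0 hlt' hk hkE.le
  have hshift := abFilling_tppP_shift_le_abFilling_add (Δ := Δ) (a := a) (b := b) (c := c) hγ (fermiEnergyOf Δ a b (c + γ) ν)
  linarith

/-- **`ε_F(b + β; ν) ≤ ε_F(b; ν) + 4β`** (`β ≥ 0`; `0 < ν < 1` attained at both rows). [folklore] -/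
theorem fermiEnergyOf_tpp_shift_le {β : ℝ} (hΔ : 0 ≤ Δ) (hc : 0 ≤ c) (hb : 0 ≤ b) (hβ : 0 ≤ β) (hν0 : 0 < ν) (hν1 : ν < 1)
    (hex : ∃ ε : ℝ, abFilling Δ a b c ε = ν) (hex' : ∃ ε : ℝ, abFilling Δ a (b + β) c ε = ν) :
    fermiEnergyOf Δ a (b + β) c ν ≤ fermiEnergyOf Δ a b c ν + 4 * β := by
  have hb' : 0 ≤ b + β := by linarith
  have h : abFilling Δ a b c (fermiEnergyOf Δ a b c ν) = ν := abFilling_fermiEnergyOf hΔ hc hb hν0 hν1 hex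
  have h' : abFilling Δ a (b + β) c (fermiEnergyOf Δ a (b + β) c ν) = ν := abFilling_fermiEnergyOf hΔ hc hb' hν0 hν1 hex'
  by_contra hlt
  push Not at hlt
  obtain ⟨k, hk, hkE⟩ := exists_gt_of_abFilling_lt_one (Δ := Δ) (a := a) (b := b + β) (c := c)
    (ε := fermiEnergyOf Δ a (b + β) c ν) (by rw [h']; exact hν1)
  have h0 : 0 ≤ fermiEnergyOf Δ a b c ν + 4 * β := by
    have := fermiEnergyOf_nonneg hΔ hc hb hν0 hν1 hex; linarith
  have hstrict := abFilling_lt_abFilling (a := a) hΔ hc hb' h0 hlt hk hkE.le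
  have hshift := abFilling_le_abFilling_tpp_shift_add (Δ := Δ) (a := a) (b := b) (c := c) hβ (fermiEnergyOf Δ a b c ν)
  linarith

/-- **`t_pp′` BRACKET, certificate-free** (`Δ > 0`, `t_pd ≠ 0`, `γ ≥ 0`): `ε_F(c + γ; ν) ∈ [ε_F(c; ν) − 4γ, ε_F(c; ν)]`. [folklore] -/
theorem fermiEnergyOf_tppP_shift_mem_Icc {γ : ℝ} (hΔ : 0 < Δ) (ha : a ≠ 0) (hc : 0 ≤ c) (hb : 0 ≤ b) (hγ : 0 ≤ γ) (hν0 : 0 < ν) (hν1 : ν < 1) :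
    fermiEnergyOf Δ a b (c + γ) ν ∈ Icc (fermiEnergyOf Δ a b c ν - 4 * γ) (fermiEnergyOf Δ a b c ν) := by
  obtain ⟨e1, -, he1⟩ := exists_fermiEnergy_of_mem_Ioo hΔ ha hc hb hν0 hν1
  obtain ⟨e2, -, he2⟩ := exists_fermiEnergy_of_mem_Ioo hΔ ha (by linarith : 0 ≤ c + γ) hb hν0 hν1
  exact ⟨fermiEnergyOf_sub_le_tppP_shift hΔ.le hc hb hγ hν0 hν1 ⟨e1, he1⟩ ⟨e2, he2⟩,
    fermiEnergyOf_anti_tppP hΔ ha hc hb hγ hν0 hν1 ⟨e1, he1⟩ ⟨e2, he2⟩⟩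

/-- **`t_pp` BRACKET, certificate-free** (`Δ > 0`, `t_pd ≠ 0`, `β ≥ 0`): `ε_F(b + β; ν) ∈ [ε_F(b; ν), ε_F(b; ν) + 4β]`. [folklore] -/
theorem fermiEnergyOf_tpp_shift_mem_Icc {β : ℝ} (hΔ : 0 < Δ) (ha : a ≠ 0) (hc : 0 ≤ c) (hb : 0 ≤ b) (hβ : 0 ≤ β) (hν0 : 0 < ν) (hν1 : ν < 1) :
    fermiEnergyOf Δ a (b + β) c ν ∈ Icc (fermiEnergyOf Δ a b c ν) (fermiEnergyOf Δ a b c ν + 4 * β) := by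
  obtain ⟨e1, -, he1⟩ := exists_fermiEnergy_of_mem_Ioo hΔ ha hc hb hν0 hν1
  obtain ⟨e2, -, he2⟩ := exists_fermiEnergy_of_mem_Ioo hΔ ha hc (by linarith : 0 ≤ b + β) hν0 hν1
  exact ⟨fermiEnergyOf_mono_tpp hΔ.le hc hb (by linarith) hν0 hν1 ⟨e1, he1⟩ ⟨e2, he2⟩,
    fermiEnergyOf_tpp_shift_le hΔ.le hc hb hβ hν0 hν1 ⟨e1, he1⟩ ⟨e2, he2⟩⟩

/-- **THE FERMI ENERGY IS 4-LIPSCHITZ IN `t_pp′`**: `|ε_F(c + γ; ν) − ε_F(c; ν)| ≤ 4γ`. [folklore] -/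
theorem abs_fermiEnergyOf_tppP_shift_sub_le {γ : ℝ} (hΔ : 0 < Δ) (ha : a ≠ 0) (hc : 0 ≤ c) (hb : 0 ≤ b) (hγ : 0 ≤ γ) (hν0 : 0 < ν) (hν1 : ν < 1) :
    |fermiEnergyOf Δ a b (c + γ) ν - fermiEnergyOf Δ a b c ν| ≤ 4 * γ := by
  obtain ⟨h1, h2⟩ := fermiEnergyOf_tppP_shift_mem_Icc hΔ ha hc hb hγ hν0 hν1
  rw [abs_le]; constructor <;> linarith

/-- **THE FERMI ENERGY IS 4-LIPSCHITZ IN `t_pp`**: `|ε_F(b + β; ν) − ε_F(b; ν)| ≤ 4β`. [folklore] -/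
theorem abs_fermiEnergyOf_tpp_shift_sub_le {β : ℝ} (hΔ : 0 < Δ) (ha : a ≠ 0) (hc : 0 ≤ c) (hb : 0 ≤ b) (hβ : 0 ≤ β) (hν0 : 0 < ν) (hν1 : ν < 1) :
    |fermiEnergyOf Δ a (b + β) c ν - fermiEnergyOf Δ a b c ν| ≤ 4 * β := by
  obtain ⟨h1, h2⟩ := fermiEnergyOf_tpp_shift_mem_Icc hΔ ha hc hb hβ hν0 hν1
  rw [abs_le]; constructor <;> linarith

end Fermi

end Summit.Ventures.CertifiedManyBodySolver.Downfold.Emery
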